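import Summits.CriticalPhenomena.PercolationContinuityZ3.Theorems.PercNearOneGluingNoHeavyLowerTailAntitheticDomTopAll
import Summits.CriticalPhenomena.PercolationContinuityZ3.Theorems.PercNearOneGluingNoHeavyLowerTailAntitheticTwinTopAll
import Summits.CriticalPhenomena.PercolationContinuityZ3.Theorems.PercNearOneGluingNoHeavyLowerTailAntitheticTopEar
import HarnessLib

/-!
# `NoHeavyLowerTail` (stmt-CriticalPhenomena-4575) — antithetic cluster pairs: **(M)_shift and CONJECTURE Δ2 on chorded ears over a target
# that DOMINATES the source** — corollaries of THEOREM TWD / TW via LEMMA D2Q-T and THEOREM T-EAR (prim-hp-2 gen 74, HOME/THEOREM-TWIN.md §4)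

Support file (`--supports stmt-CriticalPhenomena-4575`, hull-port prover `prim-hp-2`, gen 74).  No definitions, no named facts, no sorries;
standard axioms.  THEOREM T-EAR (…AntitheticTopEar, gen 69) and LEMMA D2Q-T were CONDITIONAL on TOP_shift(K; P) of the core; THEOREM TWD
(…AntitheticDomTopAll) / THEOREM TW (…AntitheticTwinTopAll) supply that hypothesis whenever `P` dominates `s` in `K` (`sP ∉ K`,
`N_K(s) ⊆ N_K(P)`), in particular at every twin.  Hence, for EVERY finite core `K` avoiding `Q` and every such `s, P`:
* `Antithetic.Dom.mixed_shift_nonneg_dom` — (M)_shift(`K + sQ + QP`; P, Q) ≥ 0: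
  `0 ≤ Σ_{T : P ∈ X_E T, Q ∉ Y_E T} (F⁺(X_E T) − F⁻(Y_E T))(G⁺(X_E T) − G⁻(Y_E T))`, `E = K + sQ + QP`;
* `Antithetic.Dom.chorded_ear_vertex_sum_nonneg_dom` — CONJECTURE Δ2 at the free vertex `x` of every CHORDED EAR `s – Q – x – y … – P`
  (chord `QP`) attached to `K` at a vertex `P` dominating `s`: the |R| = 1 vertex antithetic inequality at `x` for
  `E = ((K + sQ + QP) ∪ arm P…y) + xQ + xy`, all monotone `F, G` — with no hypothesis on `K` beyond domination (T-EAR′ needed `sP ∈ K`, TE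
  needed nested tops);
* `Antithetic.Twin.chorded_ear_vertex_sum_nonneg_twin` — the same at a twin `P` of `s` in `K`.
[cite: VandenbergHaggstromKahn2005, §1 p. 6 ("Harris' inequality"), §1 p. 3 (open cluster `C_s`)]
-/

noncomputable section

namespace Summit.CriticalPhenomena.PercolationContinuityZ3.Theorems

open Literature.Probability.Percolation
open scoped Classical

namespace Antithetic

variable {V : Type*} [Fintype V]

namespace Dom

/-- **(M)_shift over a dominating target.**  `K` avoiding `Q`; `s, P, Q` pairwise distinct; `sP ∉ K` and every `K`-neighbour of `s` is a
`K`-neighbour of `P`.  Then (M)_shift(`K + sQ + QP`; P, Q): for all monotone `F⁻ ≤ F⁺`, `G⁻ ≤ G⁺`,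
`0 ≤ Σ_{T : P ∈ X_E T, Q ∉ Y_E T} (F⁺(X_E T) − F⁻(Y_E T))(G⁺(X_E T) − G⁻(Y_E T))`. [this work] -/
theorem mixed_shift_nonneg_dom (K : Set (Sym2 V)) (s P Q : V) (hsQ : s ≠ Q) (hPQ : P ≠ Q) (hsP : s ≠ P)
    (hQK : ∀ e ∈ K, Q ∉ e) (hsPK : s(s, P) ∉ K) (hdom : ∀ v, v ≠ s → v ≠ P → s(s, v) ∈ K → s(P, v) ∈ K)
    (Fp Fm Gp Gm : Set V → ℝ) (hFp : Monotone Fp) (hFm : Monotone Fm) (hF : ∀ S, Fm S ≤ Fp S)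
    (hGp : Monotone Gp) (hGm : Monotone Gm) (hG : ∀ S, Gm S ≤ Gp S) :
    0 ≤ ∑ T ∈ Finset.univ.filter (fun T : Set (Sym2 V) =>
        P ∈ openCluster (T ∩ insert s(s, Q) (insert s(Q, P) K)) s ∧ Q ∉ openCluster (Tᶜ ∩ insert s(s, Q) (insert s(Q, P) K)) s),
      (Fp (openCluster (T ∩ insert s(s, Q) (insert s(Q, P) K)) s) - Fm (openCluster (Tᶜ ∩ insert s(s, Q) (insert s(Q, P) K)) s)) *
        (Gp (openCluster (T ∩ insert s(s, Q) (insert s(Q, P) K)) s) - Gm (openCluster (Tᶜ ∩ insert s(s, Q) (insert s(Q, P) K)) s)) :=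
  TopEar.mixed_shift_nonneg_of_top K s P Q hsQ hPQ hsP hQK
    (fun Fp' Fm' Gp' Gm' hFp' hFm' hF' hGp' hGm' hG' =>
      top_shift_sum_nonneg_dom K s P hsP hsPK hdom Fp' Fm' Gp' Gm' hFp' hFm' hF' hGp' hGm' hG')
    Fp Fm Gp Gm hFp hFm hF hGp hGm hG

/-- **CONJECTURE Δ2 on a chorded ear over a dominating target.**  `K` loop-free avoiding `Q`; `s, P, Q` pairwise distinct; `sP ∉ K`,
`N_K(s) ⊆ N_K(P)`; an arm `P = u 0, …, u a = y` of fresh vertices; `x` fresh joined to `y` and `Q`.  Then for all monotone `F, G` the vertex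
antithetic inequality holds at `x` for `E = ((K + sQ + QP) ∪ arm) + xQ + xy`. [this work] -/
theorem chorded_ear_vertex_sum_nonneg_dom {K : Set (Sym2 V)} {s P Q : V} {u : ℕ → V} {a : ℕ}
    (hnd : ∀ f ∈ K, ¬ f.IsDiag) (hQK : ∀ e ∈ K, Q ∉ e) (hsQ : s ≠ Q) (hPQ : P ≠ Q) (hsP : s ≠ P)
    (hsPK : s(s, P) ∉ K) (hdom : ∀ v, v ≠ s → v ≠ P → s(s, v) ∈ K → s(P, v) ∈ K)
    (hu0 : u 0 = P) (hufresh : ∀ i, 0 < i → i ≤ a → ∀ f ∈ insert s(s, Q) (insert s(Q, P) K), u i ∈ f → f.IsDiag)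
    (huinj : ∀ i j, i ≤ a → j ≤ a → u i = u j → i = j) (hsu : ∀ i, 0 < i → i ≤ a → s ≠ u i) (hQu : ∀ i, 0 < i → i ≤ a → Q ≠ u i)
    {x : V} (hx : ∀ f ∈ insert s(s, Q) (insert s(Q, P) K) ∪ Cyc.edgeSet a u, x ∈ f → f.IsDiag) (hxs : x ≠ s) (hxy : x ≠ u a)
    (hxQ : x ≠ Q) (hyQ : u a ≠ Q) (hg : s(u a, Q) ∉ insert s(s, Q) (insert s(Q, P) K) ∪ Cyc.edgeSet a u)
    {F G : Set V → ℝ} (hF : Monotone F) (hG : Monotone G) :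
    0 ≤ ∑ ω ∈ Finset.univ.filter (fun ω : Set (Sym2 V) =>
        ¬ ((openGraph (ω ∩ insert s(x, Q) (insert s(x, u a)
              (insert s(s, Q) (insert s(Q, P) K) ∪ Cyc.edgeSet a u)))).Reachable s x ∧
          (openGraph (ωᶜ ∩ insert s(x, Q) (insert s(x, u a)
              (insert s(s, Q) (insert s(Q, P) K) ∪ Cyc.edgeSet a u)))).Reachable s x)),
      (F (openCluster (ω ∩ insert s(x, Q) (insert s(x, u a) (insert s(s, Q) (insert s(Q, P) K) ∪ Cyc.edgeSet a u))) s) -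
          F (openCluster (ωᶜ ∩ insert s(x, Q) (insert s(x, u a) (insert s(s, Q) (insert s(Q, P) K) ∪ Cyc.edgeSet a u))) s)) *
        (G (openCluster (ω ∩ insert s(x, Q) (insert s(x, u a) (insert s(s, Q) (insert s(Q, P) K) ∪ Cyc.edgeSet a u))) s) -
          G (openCluster (ωᶜ ∩ insert s(x, Q) (insert s(x, u a) (insert s(s, Q) (insert s(Q, P) K) ∪ Cyc.edgeSet a u))) s)) :=
  TopEar.chorded_ear_vertex_sum_nonneg hnd hQK hsQ hPQ hsP
    (fun Fp' Fm' Gp' Gm' hFp' hFm' hF' hGp' hGm' hG' =>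
      top_shift_sum_nonneg_dom K s P hsP hsPK hdom Fp' Fm' Gp' Gm' hFp' hFm' hF' hGp' hGm' hG')
    hu0 hufresh huinj hsu hQu hx hxs hxy hxQ hyQ hg hF hG

end Dom

namespace Twin

/-- **CONJECTURE Δ2 on a chorded ear over a twin.**  As `Dom.chorded_ear_vertex_sum_nonneg_dom` for twins `s, P` of the core `K`
(`sP ∉ K`, `N_K(s) ∖ P = N_K(P) ∖ s`). [this work] -/
theorem chorded_ear_vertex_sum_nonneg_twin {K : Set (Sym2 V)} {s P Q : V} {u : ℕ → V} {a : ℕ}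
    (hnd : ∀ f ∈ K, ¬ f.IsDiag) (hQK : ∀ e ∈ K, Q ∉ e) (hsQ : s ≠ Q) (hPQ : P ≠ Q) (hsP : s ≠ P)
    (hsPK : s(s, P) ∉ K) (htwin : ∀ v, v ≠ s → v ≠ P → (s(s, v) ∈ K ↔ s(P, v) ∈ K))
    (hu0 : u 0 = P) (hufresh : ∀ i, 0 < i → i ≤ a → ∀ f ∈ insert s(s, Q) (insert s(Q, P) K), u i ∈ f → f.IsDiag)
    (huinj : ∀ i j, i ≤ a → j ≤ a → u i = u j → i = j) (hsu : ∀ i, 0 < i → i ≤ a → s ≠ u i) (hQu : ∀ i, 0 < i → i ≤ a → Q ≠ u i)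
    {x : V} (hx : ∀ f ∈ insert s(s, Q) (insert s(Q, P) K) ∪ Cyc.edgeSet a u, x ∈ f → f.IsDiag) (hxs : x ≠ s) (hxy : x ≠ u a)
    (hxQ : x ≠ Q) (hyQ : u a ≠ Q) (hg : s(u a, Q) ∉ insert s(s, Q) (insert s(Q, P) K) ∪ Cyc.edgeSet a u)
    {F G : Set V → ℝ} (hF : Monotone F) (hG : Monotone G) :
    0 ≤ ∑ ω ∈ Finset.univ.filter (fun ω : Set (Sym2 V) =>
        ¬ ((openGraph (ω ∩ insert s(x, Q) (insert s(x, u a)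
              (insert s(s, Q) (insert s(Q, P) K) ∪ Cyc.edgeSet a u)))).Reachable s x ∧
          (openGraph (ωᶜ ∩ insert s(x, Q) (insert s(x, u a)
              (insert s(s, Q) (insert s(Q, P) K) ∪ Cyc.edgeSet a u)))).Reachable s x)),
      (F (openCluster (ω ∩ insert s(x, Q) (insert s(x, u a) (insert s(s, Q) (insert s(Q, P) K) ∪ Cyc.edgeSet a u))) s) -
          F (openCluster (ωᶜ ∩ insert s(x, Q) (insert s(x, u a) (insert s(s, Q) (insert s(Q, P) K) ∪ Cyc.edgeSet a u))) s)) *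
        (G (openCluster (ω ∩ insert s(x, Q) (insert s(x, u a) (insert s(s, Q) (insert s(Q, P) K) ∪ Cyc.edgeSet a u))) s) -
          G (openCluster (ωᶜ ∩ insert s(x, Q) (insert s(x, u a) (insert s(s, Q) (insert s(Q, P) K) ∪ Cyc.edgeSet a u))) s)) :=
  TopEar.chorded_ear_vertex_sum_nonneg hnd hQK hsQ hPQ hsP
    (fun Fp' Fm' Gp' Gm' hFp' hFm' hF' hGp' hGm' hG' =>
      top_shift_sum_nonneg_twin K s P hsP hsPK htwin Fp' Fm' Gp' Gm' hFp' hFm' hF' hGp' hGm' hG')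
    hu0 hufresh huinj hsu hQu hx hxs hxy hxQ hyQ hg hF hG

end Twin

end Antithetic

end Summit.CriticalPhenomena.PercolationContinuityZ3.Theorems
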